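import Summits.Schanuel.Schanuel.Theses.RigidCore
import Literature.NumberTheory.Transcendental.ExpPointsExamples
import Literature.NumberTheory.Transcendental.ExpPointsCuspTrichotomy
import Literature.NumberTheory.Transcendental.ExpPointsCuspTrichotomyAlg
import Literature.NumberTheory.Transcendental.ExpPointsCoordinateChange
import Literature.NumberTheory.Transcendental.ExpPointsGeometryBasic
import Literature.NumberTheory.Transcendental.ExpPointsBranchAtInfinity
import Literature.NumberTheory.Transcendental.ExpPointsLogFreeUniformize
import Literature.NumberTheory.Transcendental.ExpPointsLogFreeUniformizeAlg
import Literature.NumberTheory.Transcendental.ExpPointsCuspNormalForm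
import Literature.NumberTheory.Transcendental.ExpPointsCuspTranscendence

/-!
# `stub_cuspEscapeAlg` (E⁺) for the line `cusp-germ-schneider-sparsity` of crux `RigidCore.SparsityTwo`

WHAT. The geometric escape trichotomy `stub_cuspEscape` (E, landed in
`RigidCoreSparsityTwoCuspEscape`) for a `ℚ`-defined `W ⊆ ℂ² × ℂ²` of Zariski dimension `< 2` with
infinitely many `ℚ`-linearly independent exponential points, whose first case (a normalised
log-free cusp ray with transcendental tail carrying infinitely many ray hits) now comes WITH THE
ALGEBRAIC UNIFORMISATION of the cusp: a substitution `t = T σ` (`T` analytic at `0`, `T 0 = 0`),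
germs `ℓ₀, ℓ₁, Φ₁` analytic at `0`, `N₀ ∈ ℕ` and `r > 0` such that the `t`-branch
`((t⁻ᵉ, Φ₁ t / t^{N₀}) ∘ s, (e^{ℓ₀ t}, e^{ℓ₁ t}) ∘ s)` lies in `W` for `0 < |t| < r`, and the cusp point
at `σ` is the `t`-branch point at `t = T σ`: `(T σ)⁻ᵉ = 2πi σ⁻ᵉ + ℓu σ`,
`Φ₁ (T σ) / (T σ)^{N₀} = 2πi (A(σ⁻¹) + g σ) + ℓv σ`, `ℓ₀ (T σ) = ℓu σ`, `ℓ₁ (T σ) = ℓv σ`.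

SOURCE / DESIGN. E's pipeline constructs this substitution internally (`t = τ(η s)` in
`ExpPointsLogFreeUniformize.exists_cusp_form_of_logFree`, `ℓu := ℓ₀ ∘ T`, `ℓv := ℓ₁ ∘ T`) and
forgets it; the Literature files `ExpPointsLogFreeUniformizeAlg` (cusp form with the substitution
remembered) and `ExpPointsCuspTrichotomyAlg` (sign normalisation by complex conjugation, and the
trichotomy, carrying the substitution) re-run it keeping the data. As in
`RigidCoreSparsityTwoCuspEscape`, this file only reduces a polar SECOND coordinate to the first
one by the simultaneous swap of both coordinate blocks (`ExpPointsCoordinateChange`); the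
`t`-branch membership is written with the same `∘ s` pattern as the cusp ray and transforms the
same way.
-/

-- `Summit.Schanuel.Schanuel.…` repeats `Schanuel` (summit = problem); the tree builds warning-free (lead c2 hygiene fix)
set_option linter.dupNamespace false

namespace Summit.Schanuel.Schanuel.Cruxes.SparsityTwo.CuspGermSchneiderSparsity

open Filter Topology Complex Polynomial Literature.NumberTheory.Transcendental
open scoped Real

/-- The trichotomy with algebraic uniformisation when the FIRST coordinate is unbounded on the
independent hits. -/
theorem cuspEscape_of_unbounded_fst_alg (W : Set (Fin 2 ⊕ Fin 2 → ℂ))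
    (hW : IsDefinedOver (⊥ : Subfield ℂ) W) (hdim : zariskiDim ℂ W < 2)
    (h0 : ∀ R : ℝ, Set.Infinite {x : Fin 2 → ℂ | x ∈ indepExpPoints W ∧ R < ‖x 0‖}) :
    (∃ (s : Fin 2 ≃ Fin 2) (e : ℕ) (A : Polynomial ℂ) (g ℓu ℓv : ℂ → ℂ) (ρ : ℝ)
        (N₀ : ℕ) (T ℓ₀ ℓ₁ Φ₁ : ℂ → ℂ) (r : ℝ),
        let w : ℕ → ℂ := fun N => (((N : ℝ) ^ ((e : ℝ)⁻¹) : ℝ) : ℂ);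
        let x : ℕ → Fin 2 → ℂ := fun N =>
          (![2 * ↑π * I * (N : ℂ) + ℓu (w N)⁻¹,
              2 * ↑π * I * (A.eval (w N) + g (w N)⁻¹) + ℓv (w N)⁻¹] : Fin 2 → ℂ) ∘ s;
        let y : ℕ → Fin 2 → ℂ := fun N =>
          (![Complex.exp (ℓu (w N)⁻¹), Complex.exp (ℓv (w N)⁻¹)] : Fin 2 → ℂ) ∘ s;
        (0 < e ∧ 0 < ρ ∧ AnalyticAt ℂ g 0 ∧ g 0 = 0 ∧ AnalyticAt ℂ ℓu 0 ∧ AnalyticAt ℂ ℓv 0 ∧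
        (¬ ∃ P : MvPolynomial (Fin 2) ℂ, P ≠ 0 ∧
            ∀ᶠ z in 𝓝 (0 : ℂ), MvPolynomial.eval ![z, g z] P = 0) ∧
        (∀ σ : ℂ, 0 < ‖σ‖ → ‖σ‖ < ρ →
          Sum.elim ((![2 * ↑π * I * σ⁻¹ ^ e + ℓu σ,
                        2 * ↑π * I * (A.eval σ⁻¹ + g σ) + ℓv σ] : Fin 2 → ℂ) ∘ s)
            ((![Complex.exp (ℓu σ), Complex.exp (ℓv σ)] : Fin 2 → ℂ) ∘ s) ∈ W) ∧
        Set.Infinite {N : ℕ | x N ∈ indepExpPoints W ∧ Complex.exp ∘ x N = y N ∧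
          ∃ L : ℤ, A.eval (w N) + g (w N)⁻¹ = L}) ∧
        (0 < r ∧ AnalyticAt ℂ T 0 ∧ T 0 = 0 ∧ AnalyticAt ℂ ℓ₀ 0 ∧ AnalyticAt ℂ ℓ₁ 0 ∧
          AnalyticAt ℂ Φ₁ 0 ∧
        (∀ t : ℂ, 0 < ‖t‖ → ‖t‖ < r →
          Sum.elim ((![(t ^ e)⁻¹, Φ₁ t / t ^ N₀] : Fin 2 → ℂ) ∘ s)
            ((![Complex.exp (ℓ₀ t), Complex.exp (ℓ₁ t)] : Fin 2 → ℂ) ∘ s) ∈ W) ∧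
        (∀ σ : ℂ, 0 < ‖σ‖ → ‖σ‖ < ρ → 0 < ‖T σ‖ ∧ ‖T σ‖ < r ∧
          ((T σ) ^ e)⁻¹ = 2 * ↑π * I * σ⁻¹ ^ e + ℓu σ ∧
          Φ₁ (T σ) / (T σ) ^ N₀ = 2 * ↑π * I * (A.eval σ⁻¹ + g σ) + ℓv σ ∧
          ℓ₀ (T σ) = ℓu σ ∧ ℓ₁ (T σ) = ℓv σ))) ∨
      (∃ a b : ℤ, (a ≠ 0 ∨ b ≠ 0) ∧ ∃ c : ℂ,
        Set.Infinite {x : Fin 2 → ℂ | x ∈ indepExpPoints W ∧ (a : ℂ) * x 0 + (b : ℂ) * x 1 = c}) ∨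
      (∃ ω : Fin 2 → ℂ,
        Set.Infinite {x : Fin 2 → ℂ | x ∈ indepExpPoints W ∧ Complex.exp ∘ x = ω}) := by
  obtain ⟨e, he, N, r, hr, Φ₁, Φ₂, Φ₃, hana, hWb, hhit⟩ :=
    exists_branch_through_hits hW.isZariskiClosed hdim (T := indepExpPoints W) subset_rfl h0
  exact cusp_trichotomy_alg hW hdim he hr hana hWb hhit

/-- **stub_cuspEscapeAlg** (E⁺; provable now, size M: E's pipeline with the algebraic branch exposed). Same hypotheses
and same trichotomy as `stub_cuspEscape`; in case (1) the normalised log-free cusp ray comes WITH its algebraic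
uniformisation: an analytic `T` at `0`, `T 0 = 0`, analytic `ℓ₀ ℓ₁ Φ₁` and `N₀`, `r > 0` such that the `t`-branch
`((t⁻ᵉ, Φ₁ t / t^{N₀}) ∘ s, (e^{ℓ₀ t}, e^{ℓ₁ t}) ∘ s)` lies in `W` for `0 < ‖t‖ < r` and the cusp point at `σ` IS the
`t`-branch point at `t = T σ`: `(T σ)⁻ᵉ = 2πi σ⁻ᵉ + ℓu σ`, `Φ₁ (T σ)/(T σ)^{N₀} = 2πi (A(σ⁻¹) + g σ) + ℓv σ`,
`ℓ₀ (T σ) = ℓu σ`, `ℓ₁ (T σ) = ℓv σ` (in `exists_cusp_form_of_logFree`: `T s = τ (η s)`, `ℓu := ℓ₀ ∘ T`,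
`ℓv := ℓ₁ ∘ T`, identity `hident`; conjugated by `exists_normalised_cusp` when `ε = -1`, coordinate-swapped in the
second case of `stub_cuspEscape`). -/
theorem stub_cuspEscapeAlg :
    ∀ (W : Set (Fin 2 ⊕ Fin 2 → ℂ)), IsDefinedOver (⊥ : Subfield ℂ) W → zariskiDim ℂ W < 2 →
      (indepExpPoints W).Infinite →
      (∃ (s : Fin 2 ≃ Fin 2) (e : ℕ) (A : Polynomial ℂ) (g ℓu ℓv : ℂ → ℂ) (ρ : ℝ)
          (N₀ : ℕ) (T ℓ₀ ℓ₁ Φ₁ : ℂ → ℂ) (r : ℝ),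
        let w : ℕ → ℂ := fun N => (((N : ℝ) ^ ((e : ℝ)⁻¹) : ℝ) : ℂ);
        let x : ℕ → Fin 2 → ℂ := fun N =>
          (![2 * ↑π * I * (N : ℂ) + ℓu (w N)⁻¹,
              2 * ↑π * I * (A.eval (w N) + g (w N)⁻¹) + ℓv (w N)⁻¹] : Fin 2 → ℂ) ∘ s;
        let y : ℕ → Fin 2 → ℂ := fun N =>
          (![Complex.exp (ℓu (w N)⁻¹), Complex.exp (ℓv (w N)⁻¹)] : Fin 2 → ℂ) ∘ s;
        (0 < e ∧ 0 < ρ ∧ AnalyticAt ℂ g 0 ∧ g 0 = 0 ∧ AnalyticAt ℂ ℓu 0 ∧ AnalyticAt ℂ ℓv 0 ∧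
        (¬ ∃ P : MvPolynomial (Fin 2) ℂ, P ≠ 0 ∧
            ∀ᶠ z in 𝓝 (0 : ℂ), MvPolynomial.eval ![z, g z] P = 0) ∧
        (∀ σ : ℂ, 0 < ‖σ‖ → ‖σ‖ < ρ →
          Sum.elim ((![2 * ↑π * I * σ⁻¹ ^ e + ℓu σ,
                        2 * ↑π * I * (A.eval σ⁻¹ + g σ) + ℓv σ] : Fin 2 → ℂ) ∘ s)
            ((![Complex.exp (ℓu σ), Complex.exp (ℓv σ)] : Fin 2 → ℂ) ∘ s) ∈ W) ∧
        Set.Infinite {N : ℕ | x N ∈ indepExpPoints W ∧ Complex.exp ∘ x N = y N ∧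
          ∃ L : ℤ, A.eval (w N) + g (w N)⁻¹ = L}) ∧
        (0 < r ∧ AnalyticAt ℂ T 0 ∧ T 0 = 0 ∧ AnalyticAt ℂ ℓ₀ 0 ∧ AnalyticAt ℂ ℓ₁ 0 ∧ AnalyticAt ℂ Φ₁ 0 ∧
        (∀ t : ℂ, 0 < ‖t‖ → ‖t‖ < r →
          Sum.elim ((![(t ^ e)⁻¹, Φ₁ t / t ^ N₀] : Fin 2 → ℂ) ∘ s)
            ((![Complex.exp (ℓ₀ t), Complex.exp (ℓ₁ t)] : Fin 2 → ℂ) ∘ s) ∈ W) ∧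
        (∀ σ : ℂ, 0 < ‖σ‖ → ‖σ‖ < ρ → 0 < ‖T σ‖ ∧ ‖T σ‖ < r ∧
          ((T σ) ^ e)⁻¹ = 2 * ↑π * I * σ⁻¹ ^ e + ℓu σ ∧
          Φ₁ (T σ) / (T σ) ^ N₀ = 2 * ↑π * I * (A.eval σ⁻¹ + g σ) + ℓv σ ∧
          ℓ₀ (T σ) = ℓu σ ∧ ℓ₁ (T σ) = ℓv σ))) ∨
      (∃ a b : ℤ, (a ≠ 0 ∨ b ≠ 0) ∧ ∃ c : ℂ,
        Set.Infinite {x : Fin 2 → ℂ | x ∈ indepExpPoints W ∧ (a : ℂ) * x 0 + (b : ℂ) * x 1 = c}) ∨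
      (∃ ω : Fin 2 → ℂ,
        Set.Infinite {x : Fin 2 → ℂ | x ∈ indepExpPoints W ∧ Complex.exp ∘ x = ω}) := by
  intro W hW hdim hinf
  obtain ⟨i, hi⟩ := exists_unbounded_coord hdim hinf
  fin_cases i
  · exact cuspEscape_of_unbounded_fst_alg W hW hdim hi
  -- the second coordinate is unbounded: swap both coordinate blocks
  set σ : Fin 2 ≃ Fin 2 := Equiv.swap 0 1 with hσ
  set W' : Set (Fin 2 ⊕ Fin 2 → ℂ) := {z | z ∘ ⇑(Equiv.sumCongr σ σ) ∈ W} with hW'def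
  have hW' : IsDefinedOver (⊥ : Subfield ℂ) W' := isDefinedOver_comp_equiv hW _
  have hdim' : zariskiDim ℂ W' < 2 := by rw [hW'def, zariskiDim_comp_equiv]; exact hdim
  have hss : ∀ z : Fin 2 → ℂ, (z ∘ σ) ∘ σ = z := fun z => by
    funext j; fin_cases j <;> simp [hσ]
  have hinj : Function.Injective fun x : Fin 2 → ℂ => x ∘ σ := fun x y hxy => by
    have := congrArg (fun f : Fin 2 → ℂ => f ∘ σ) hxy
    simpa only [hss] using this
  have hmem : ∀ x : Fin 2 → ℂ, x ∈ indepExpPoints W → x ∘ σ ∈ indepExpPoints W' := by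
    intro x hx
    rw [mem_indepExpPoints_comp_swap, hss]
    exact hx
  have h0' : ∀ R : ℝ, Set.Infinite {x : Fin 2 → ℂ | x ∈ indepExpPoints W' ∧ R < ‖x 0‖} := by
    intro R
    refine ((hi R).image hinj.injOn).mono ?_
    rintro _ ⟨x, ⟨hxH, hxR⟩, rfl⟩
    exact ⟨hmem x hxH, by simpa [hσ] using hxR⟩
  rcases cuspEscape_of_unbounded_fst_alg W' hW' hdim' h0' with h1 | h2 | h3
  · -- (1): compose the coordinate choice with the swap
    obtain ⟨s, e, A, g, ℓu, ℓv, ρ, N₀, T, ℓ₀, ℓ₁, Φ₁, r, ⟨he, hρ, hg, hg0, hℓu, hℓv, htr, hbr, hN⟩,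
      hr, hT, hT0, hℓ₀, hℓ₁, hΦ₁, hbrt, hlink⟩ := h1
    refine Or.inl ⟨σ.trans s, e, A, g, ℓu, ℓv, ρ, N₀, T, ℓ₀, ℓ₁, Φ₁, r, ?_⟩
    intro w x y
    refine ⟨⟨he, hρ, hg, hg0, hℓu, hℓv, htr, fun τ hτ0 hτρ => ?_, ?_⟩, hr, hT, hT0, hℓ₀, hℓ₁, hΦ₁,
      fun t ht0 htr' => ?_, hlink⟩
    · have := hbr τ hτ0 hτρ
      rw [hW'def, Set.mem_setOf_eq, sumElim_comp_sumCongr] at this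
      simpa only [Equiv.coe_trans, Function.comp_assoc] using this
    · simp only [w, x, y]
      refine hN.mono ?_
      rintro n ⟨hH, hexp, hL⟩
      refine ⟨?_, ?_, hL⟩
      · have := (mem_indepExpPoints_comp_swap σ).1 hH
        simpa only [Equiv.coe_trans, Function.comp_assoc] using this
      · have := congrArg (fun f : Fin 2 → ℂ => f ∘ σ) hexp
        simpa only [Equiv.coe_trans, Function.comp_assoc] using this
    · have := hbrt t ht0 htr'
      rw [hW'def, Set.mem_setOf_eq, sumElim_comp_sumCongr] at this
      simpa only [Equiv.coe_trans, Function.comp_assoc] using this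
  · -- (2): the swapped section
    obtain ⟨a, b, hab, c, hinf2⟩ := h2
    refine Or.inr (Or.inl ⟨b, a, hab.symm, c, ((hinf2.image hinj.injOn)).mono ?_⟩)
    rintro _ ⟨x, ⟨hxH, hxc⟩, rfl⟩
    refine ⟨(mem_indepExpPoints_comp_swap σ).1 hxH, ?_⟩
    simp only [Function.comp_apply, hσ, Equiv.swap_apply_left, Equiv.swap_apply_right]
    rw [← hxc]; ring
  · -- (3): the swapped fibre
    obtain ⟨ω, hinf3⟩ := h3
    refine Or.inr (Or.inr ⟨ω ∘ σ, (hinf3.image hinj.injOn).mono ?_⟩)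
    rintro _ ⟨x, ⟨hxH, hxω⟩, rfl⟩
    refine ⟨(mem_indepExpPoints_comp_swap σ).1 hxH, ?_⟩
    show (Complex.exp ∘ x) ∘ σ = ω ∘ σ
    rw [hxω]

end Summit.Schanuel.Schanuel.Cruxes.SparsityTwo.CuspGermSchneiderSparsity
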